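import Summits.QuantumFields.YangMills.Theorems.BalabanUVNodesN15KingModelComplexLinkHolomorphy
import Summits.QuantumFields.YangMills.Theorems.BalabanUVNodesN15KingModelComplexLinkBounds
import Mathlib.Analysis.Complex.Liouville
import HarnessLib
/-!
# BalabanUVNodes ∕ N15 — THE KING-MODEL RUNG (PART Ϛ-k): CAUCHY ESTIMATES ALONG COMPLEX LINES IN THE WINDOW — every order of perturbation theory of the covariant fine covariance in the
# link field is bounded, uniformly in the volume, the fibre and the field: `‖∂ᵏ_t (G_{U₀+tδU, V₀+tδV})_{xy}|_{t=0}‖ ≤ k!·(m² − 2(d+1)c(ε₀+R))⁻¹·R^{−k}` for unit directions `(δU,δV)`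
# (Track A, DAG node N15 = NE2; FAN-OUT v1.1 §N15 s3 «KING-MODEL RUNG … + what the curved case adds»; count-neutral)
HONEST FRAMING.  Count-neutral (cell `pub-ymgap`, seat `pub-ymgap-dag-n15-e` g43; `--supports stmt-QuantumFields-27247 --as helper` = K3ᴬ, KEY MAP v3).  One finite torus at fixed
spacing; King's `A = 0` model, FINE covariance layer only, `𝕜 = ℂ`; nothing of Bałaban's (3.42) ∕ Thm 3.4 for `G(U)` asserted; nothing continuum ∕ ℝ⁴ ∕ OS ∕ Clay; NOT a node discharge.
WHAT IS DECIDED.  [Balaban1985BackgroundPropagators] p.399 l.33–36 «we will study the expansions with respect to the external gauge field A … the propagators are analytic functions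
of configurations U′U», Thm 3.4 p.400, (3.57) p.401 (the expansion in `V₁(A)`).  In King's model the expansion coefficients along ANY complex line in the window are controlled by
Cauchy's estimate: fix a base pair `(U₀,V₀)` with `‖U₀(b)‖, ‖V₀(b)‖ ≤ 1+ε₀`, a direction `(δU,δV)` with `‖δU(b)‖, ‖δV(b)‖ ≤ 1`, and a radius `R > 0` with `2(d+1)c(ε₀+R) < m²`; then
* §1 `norm_cxLine_le` (the line `t ↦ (U₀+tδU, V₀+tδV)` stays in the window of radius `1+ε₀+‖t‖`), `differentiableAt_cxLine`, ★ `differentiableAt_blk_cxLapF_inv_line` (the block along the line is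
  ℂ-differentiable at every `‖t‖ ≤ R`; PART Ϛ-e `analyticAt_cxLapF_inv` ∘ the affine line), `diffContOnCl_blk_cxLapF_inv_line`;
* §2 ★★★ **`norm_iteratedDeriv_blk_cxLapF_inv_line_le`** — CAUCHY's ESTIMATE, ALL ORDERS: `‖(d∕dt)ᵏ (G_{U₀+tδU,V₀+tδV})_{xy}|_{t=0}‖_{op} ≤ k!·(m² − 2(d+1)c(ε₀+R))⁻¹ ∕ Rᵏ` for EVERY `k`
  (Mathlib `Complex.norm_iteratedDeriv_le_of_forall_mem_sphere_norm_le` with PART Ϛ-c's mass bound `‖(G_{U,V})_{xy}‖ ≤ 1∕m′²` on the circle `‖t‖ = R`, which lies in the window of radius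
  `1+ε₀+R`); ★★ `norm_iteratedDeriv_cxLapF_inv_entry_line_le` (entrywise); ★★ **`norm_iteratedDeriv_blk_cxLapF_inv_line_unitary_le`** — at a UNITARY base field (`ε₀ = 0`, `V₀ = U₀^*`):
  `‖∂ᵏ_t G|_{t=0}‖ ≤ k!·(m² − 2(d+1)cR)⁻¹R^{−k}` for every `2(d+1)cR < m²` — the `k`-th order of the complexified perturbation series around PART Ͱ's `G_{U₀}` is `O(R^{−k})` with the
  radius of convergence at least `m²∕(2(d+1)c)` in every unit direction (PART Ϛ-d: sharp for the constant dilation direction).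
PRIOR TREE ART (by name): Ϛ-e (`CxLinks`, `analyticAt_cxLapF_inv`, `cxBlkCLM`, `cxEntryCLM`), Ϛ-c (`l2_opNorm_blk_cxLapF_inv_le_inv_mass`, `norm_cxLapF_inv_entry_le_inv_mass`), Ϛ-b (`isUnit_cxLapF`,
`unitary_mem_window`), Mathlib (`Complex.norm_iteratedDeriv_le_of_forall_mem_sphere_norm_le`, `DifferentiableOn.diffContOnCl`, `closure_ball`, `DifferentiableAt.smul_const`, `DifferentiableAt.prodMk`).
Dedup (rg at filing): basename 0 files; needles `cxLapF_inv_line|differentiableAt_cxLine\b|norm_cxLine_le\b` 0 tree files (sibling n15-d `norm_iteratedDeriv_kingCovPotC_le` = the scalar φ²-coupling, other object).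
Locators: [Balaban1985BackgroundPropagators] p.399 l.33–36, Thm 3.4 p.400, (3.57) p.401; [King1986] (4.4) p.670.  0 `sorry`, 0 `def`.
-/

noncomputable section
open scoped BigOperators ComplexConjugate ComplexOrder Topology Matrix.Norms.L2Operator
open Finset Matrix Filter Metric

namespace Summit.QuantumFields.YangMills.BalabanUVNodes.N15KingModelRung.Covariant

open Literature.MathematicalPhysics.QuantumFieldTheory.LatticeDiamagneticInequality (Hopping blk)
open Literature.MathematicalPhysics.QuantumFieldTheory.Balaban1983to89.B5Prop11Plancherel (Tor unitVec)
open Literature.MathematicalPhysics.QuantumFieldTheory.King1986.Torus (lapF)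

variable {d : ℕ} (K : Fin (d + 1) → ℕ) [hK : ∀ μ, NeZero (K μ)]
variable {n : Type*} [Fintype n] [DecidableEq n] {c m2 ε₀ R : ℝ}

/-! ## §1 Complex lines in the window -/

omit hK in
/-- A point of the line `U₀ + tδU` with `‖U₀(b)‖ ≤ 1+ε₀`, `‖δU(b)‖ ≤ 1` has `‖(U₀+tδU)(b)‖ ≤ 1 + (ε₀ + ‖t‖)`. [folklore] -/
theorem norm_cxLine_le {U₀ δU : Tor K × Fin (d + 1) → Matrix n n ℂ} (hU₀ : ∀ b, ‖U₀ b‖ ≤ 1 + ε₀) (hδU : ∀ b, ‖δU b‖ ≤ 1) (t : ℂ)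
    (b : Tor K × Fin (d + 1)) : ‖(U₀ + t • δU) b‖ ≤ 1 + (ε₀ + ‖t‖) := by
  rw [Pi.add_apply, Pi.smul_apply]
  refine (norm_add_le _ _).trans ?_
  rw [norm_smul]
  have h := mul_le_mul_of_nonneg_left (hδU b) (norm_nonneg t)
  rw [mul_one] at h
  linarith [hU₀ b]

/-- The line `t ↦ (U₀+tδU, V₀+tδV)` is ℂ-differentiable. [folklore] -/
theorem differentiableAt_cxLine (U₀ V₀ δU δV : Tor K × Fin (d + 1) → Matrix n n ℂ) (t : ℂ) :
    DifferentiableAt ℂ (fun s : ℂ => ((U₀ + s • δU, V₀ + s • δV) : CxLinks K ℂ n)) t :=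
  ((differentiableAt_id.smul_const δU).const_add U₀).prodMk ((differentiableAt_id.smul_const δV).const_add V₀)

/-- ★ THE BLOCK ALONG THE LINE IS ℂ-DIFFERENTIABLE at every `t` where `M` is invertible (PART Ϛ-e ∘ the affine line). [cite: Balaban1985BackgroundPropagators, Thm 3.4 p.400] -/
theorem differentiableAt_blk_cxLapF_inv_line {U₀ V₀ δU δV : Tor K × Fin (d + 1) → Matrix n n ℂ} {t : ℂ}
    (hU : IsUnit (cxLapF K c m2 (U₀ + t • δU) (V₀ + t • δV))) (x y : Tor K) :
    DifferentiableAt ℂ (fun s : ℂ => blk (cxLapF K c m2 (U₀ + s • δU) (V₀ + s • δV))⁻¹ x y) t := by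
  have hcomp : (fun s : ℂ => blk (cxLapF K c m2 (U₀ + s • δU) (V₀ + s • δV))⁻¹ x y)
      = (fun UV : CxLinks K ℂ n => blk (cxLapF K c m2 UV.1 UV.2)⁻¹ x y) ∘ (fun s : ℂ => ((U₀ + s • δU, V₀ + s • δV) : CxLinks K ℂ n)) := rfl
  rw [hcomp]
  exact (analyticAt_blk_cxLapF_inv K (UV₀ := ((U₀ + t • δU, V₀ + t • δV) : CxLinks K ℂ n)) hU x y).differentiableAt.comp t
    (differentiableAt_cxLine K U₀ V₀ δU δV t)

/-- The entry along the line is ℂ-differentiable at every `t` where `M` is invertible. [cite: Balaban1985BackgroundPropagators, Thm 3.4 p.400] -/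
theorem differentiableAt_cxLapF_inv_entry_line {U₀ V₀ δU δV : Tor K × Fin (d + 1) → Matrix n n ℂ} {t : ℂ}
    (hU : IsUnit (cxLapF K c m2 (U₀ + t • δU) (V₀ + t • δV))) (p q : Tor K × n) :
    DifferentiableAt ℂ (fun s : ℂ => (cxLapF K c m2 (U₀ + s • δU) (V₀ + s • δV))⁻¹ p q) t := by
  have hcomp : (fun s : ℂ => (cxLapF K c m2 (U₀ + s • δU) (V₀ + s • δV))⁻¹ p q)
      = (fun UV : CxLinks K ℂ n => (cxLapF K c m2 UV.1 UV.2)⁻¹ p q) ∘ (fun s : ℂ => ((U₀ + s • δU, V₀ + s • δV) : CxLinks K ℂ n)) := rfl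
  rw [hcomp]
  exact (analyticAt_cxLapF_inv_entry K (UV₀ := ((U₀ + t • δU, V₀ + t • δV) : CxLinks K ℂ n)) hU p q).differentiableAt.comp t
    (differentiableAt_cxLine K U₀ V₀ δU δV t)

/-- ★ `DiffContOnCl` ON THE DISC `‖t‖ < R` whose closure lies in the window: `2(d+1)c(ε₀+R) < m²`. [cite: Balaban1985BackgroundPropagators, Thm 3.4 p.400] -/
theorem diffContOnCl_blk_cxLapF_inv_line (hc : 0 ≤ c) (hm : 0 < m2) (hε₀ : 0 ≤ ε₀) (hR : 0 < R) (hwin : 2 * ((d : ℝ) + 1) * c * (ε₀ + R) < m2)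
    {U₀ V₀ δU δV : Tor K × Fin (d + 1) → Matrix n n ℂ} (hU₀ : ∀ b, ‖U₀ b‖ ≤ 1 + ε₀) (hV₀ : ∀ b, ‖V₀ b‖ ≤ 1 + ε₀)
    (hδU : ∀ b, ‖δU b‖ ≤ 1) (hδV : ∀ b, ‖δV b‖ ≤ 1) (x y : Tor K) :
    DiffContOnCl ℂ (fun s : ℂ => blk (cxLapF K c m2 (U₀ + s • δU) (V₀ + s • δV))⁻¹ x y) (ball (0 : ℂ) R) := by
  refine DifferentiableOn.diffContOnCl ?_
  rw [closure_ball (0 : ℂ) hR.ne']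
  intro t ht
  have htR : ‖t‖ ≤ R := by simpa only [mem_closedBall, dist_zero_right] using ht
  have hwin' : 2 * ((d : ℝ) + 1) * c * (ε₀ + ‖t‖) < m2 :=
    lt_of_le_of_lt (mul_le_mul_of_nonneg_left (by linarith) (by positivity)) hwin
  refine (differentiableAt_blk_cxLapF_inv_line K ?_ x y).differentiableWithinAt
  exact isUnit_cxLapF K hc hm (by positivity) hwin' (norm_cxLine_le K hU₀ hδU t) (norm_cxLine_le K hV₀ hδV t)

/-- The same for the entries. [cite: Balaban1985BackgroundPropagators, Thm 3.4 p.400] -/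
theorem diffContOnCl_cxLapF_inv_entry_line (hc : 0 ≤ c) (hm : 0 < m2) (hε₀ : 0 ≤ ε₀) (hR : 0 < R) (hwin : 2 * ((d : ℝ) + 1) * c * (ε₀ + R) < m2)
    {U₀ V₀ δU δV : Tor K × Fin (d + 1) → Matrix n n ℂ} (hU₀ : ∀ b, ‖U₀ b‖ ≤ 1 + ε₀) (hV₀ : ∀ b, ‖V₀ b‖ ≤ 1 + ε₀)
    (hδU : ∀ b, ‖δU b‖ ≤ 1) (hδV : ∀ b, ‖δV b‖ ≤ 1) (p q : Tor K × n) :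
    DiffContOnCl ℂ (fun s : ℂ => (cxLapF K c m2 (U₀ + s • δU) (V₀ + s • δV))⁻¹ p q) (ball (0 : ℂ) R) := by
  refine DifferentiableOn.diffContOnCl ?_
  rw [closure_ball (0 : ℂ) hR.ne']
  intro t ht
  have htR : ‖t‖ ≤ R := by simpa only [mem_closedBall, dist_zero_right] using ht
  have hwin' : 2 * ((d : ℝ) + 1) * c * (ε₀ + ‖t‖) < m2 :=
    lt_of_le_of_lt (mul_le_mul_of_nonneg_left (by linarith) (by positivity)) hwin
  refine (differentiableAt_cxLapF_inv_entry_line K ?_ p q).differentiableWithinAt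
  exact isUnit_cxLapF K hc hm (by positivity) hwin' (norm_cxLine_le K hU₀ hδU t) (norm_cxLine_le K hV₀ hδV t)

/-! ## §2 Cauchy's estimate, all orders, uniform in the volume -/

/-- ★★★ **CAUCHY's ESTIMATE ALONG COMPLEX LINES IN THE WINDOW, ALL ORDERS**: `c ≥ 0`, `m² > 0`, `ε₀ ≥ 0`, `R > 0`, `2(d+1)c(ε₀+R) < m²`; base pair with `‖U₀(b)‖, ‖V₀(b)‖ ≤ 1+ε₀`, direction
with `‖δU(b)‖, ‖δV(b)‖ ≤ 1`.  Then for EVERY `k` and all `x, y`:  `‖(d∕dt)ᵏ (G_{U₀+tδU, V₀+tδV})_{xy}|_{t=0}‖_{op} ≤ k!·(m² − 2(d+1)c(ε₀+R))⁻¹ ∕ Rᵏ` — the `k`-th coefficient of the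
perturbation series in the link field is `≤ m′⁻²R^{−k}`, uniformly in the volume, the fibre and the fields. [cite: Balaban1985BackgroundPropagators, p.399 l.33–36, Thm 3.4 p.400, (3.57) p.401] -/
theorem norm_iteratedDeriv_blk_cxLapF_inv_line_le (hc : 0 ≤ c) (hm : 0 < m2) (hε₀ : 0 ≤ ε₀) (hR : 0 < R) (hwin : 2 * ((d : ℝ) + 1) * c * (ε₀ + R) < m2)
    {U₀ V₀ δU δV : Tor K × Fin (d + 1) → Matrix n n ℂ} (hU₀ : ∀ b, ‖U₀ b‖ ≤ 1 + ε₀) (hV₀ : ∀ b, ‖V₀ b‖ ≤ 1 + ε₀)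
    (hδU : ∀ b, ‖δU b‖ ≤ 1) (hδV : ∀ b, ‖δV b‖ ≤ 1) (k : ℕ) (x y : Tor K) :
    ‖iteratedDeriv k (fun s : ℂ => blk (cxLapF K c m2 (U₀ + s • δU) (V₀ + s • δV))⁻¹ x y) 0‖
      ≤ k.factorial * (m2 - 2 * ((d : ℝ) + 1) * c * (ε₀ + R))⁻¹ / R ^ k := by
  haveI : CompleteSpace (Matrix n n ℂ) := FiniteDimensional.complete ℂ _
  refine Complex.norm_iteratedDeriv_le_of_forall_mem_sphere_norm_le k hR
    (diffContOnCl_blk_cxLapF_inv_line K hc hm hε₀ hR hwin hU₀ hV₀ hδU hδV x y) fun t ht => ?_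
  have htR : ‖t‖ = R := by simpa only [mem_sphere, dist_zero_right] using ht
  have hUt : ∀ b, ‖(U₀ + t • δU) b‖ ≤ 1 + (ε₀ + R) := fun b => by rw [← htR]; exact norm_cxLine_le K hU₀ hδU t b
  have hVt : ∀ b, ‖(V₀ + t • δV) b‖ ≤ 1 + (ε₀ + R) := fun b => by rw [← htR]; exact norm_cxLine_le K hV₀ hδV t b
  exact l2_opNorm_blk_cxLapF_inv_le_inv_mass K hc hm (by positivity) hwin hUt hVt x y

/-- ★★ **ENTRYWISE CAUCHY ESTIMATE** along complex lines in the window: `‖(d∕dt)ᵏ G((x,i),(y,j))|_{t=0}‖ ≤ k!·(m² − 2(d+1)c(ε₀+R))⁻¹ ∕ Rᵏ`.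
[cite: Balaban1985BackgroundPropagators, Thm 3.4 p.400, (3.57) p.401] -/
theorem norm_iteratedDeriv_cxLapF_inv_entry_line_le (hc : 0 ≤ c) (hm : 0 < m2) (hε₀ : 0 ≤ ε₀) (hR : 0 < R) (hwin : 2 * ((d : ℝ) + 1) * c * (ε₀ + R) < m2)
    {U₀ V₀ δU δV : Tor K × Fin (d + 1) → Matrix n n ℂ} (hU₀ : ∀ b, ‖U₀ b‖ ≤ 1 + ε₀) (hV₀ : ∀ b, ‖V₀ b‖ ≤ 1 + ε₀)
    (hδU : ∀ b, ‖δU b‖ ≤ 1) (hδV : ∀ b, ‖δV b‖ ≤ 1) (k : ℕ) (p q : Tor K × n) :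
    ‖iteratedDeriv k (fun s : ℂ => (cxLapF K c m2 (U₀ + s • δU) (V₀ + s • δV))⁻¹ p q) 0‖
      ≤ k.factorial * (m2 - 2 * ((d : ℝ) + 1) * c * (ε₀ + R))⁻¹ / R ^ k := by
  obtain ⟨x, i⟩ := p
  obtain ⟨y, j⟩ := q
  refine Complex.norm_iteratedDeriv_le_of_forall_mem_sphere_norm_le k hR
    (diffContOnCl_cxLapF_inv_entry_line K hc hm hε₀ hR hwin hU₀ hV₀ hδU hδV (x, i) (y, j)) fun t ht => ?_
  have htR : ‖t‖ = R := by simpa only [mem_sphere, dist_zero_right] using ht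
  have hUt : ∀ b, ‖(U₀ + t • δU) b‖ ≤ 1 + (ε₀ + R) := fun b => by rw [← htR]; exact norm_cxLine_le K hU₀ hδU t b
  have hVt : ∀ b, ‖(V₀ + t • δV) b‖ ≤ 1 + (ε₀ + R) := fun b => by rw [← htR]; exact norm_cxLine_le K hV₀ hδV t b
  exact norm_cxLapF_inv_entry_le_inv_mass K hc hm (by positivity) hwin hUt hVt x y i j

/-- ★★ **AT A UNITARY BASE FIELD** (`V₀ = U₀^*`, `ε₀ = 0`): for every radius `R > 0` with `2(d+1)cR < m²` and unit directions,
`‖(d∕dt)ᵏ (G_{U₀+tδU, U₀^*+tδV})_{xy}|_{t=0}‖_{op} ≤ k!·(m² − 2(d+1)cR)⁻¹ ∕ Rᵏ` — the perturbation series of the complexified covariance around PART Ͱ's unitary `G_{U₀}` (the value at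
`t = 0`, Ϛ-e `cxLapF_inv_at_unitary`) converges in every unit direction with radius at least `m²∕(2(d+1)c)` and geometrically controlled coefficients, uniformly in the volume.
[cite: Balaban1985BackgroundPropagators, p.399 l.33–36, Thm 3.4 p.400, (3.57) p.401; King1986, (4.4) p.670] -/
theorem norm_iteratedDeriv_blk_cxLapF_inv_line_unitary_le (hc : 0 ≤ c) (hm : 0 < m2) (hR : 0 < R) (hwin : 2 * ((d : ℝ) + 1) * c * R < m2)
    {U₀ δU δV : Tor K × Fin (d + 1) → Matrix n n ℂ} (hU₀ : ∀ b, U₀ b ∈ Matrix.unitaryGroup n ℂ)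
    (hδU : ∀ b, ‖δU b‖ ≤ 1) (hδV : ∀ b, ‖δV b‖ ≤ 1) (k : ℕ) (x y : Tor K) :
    ‖iteratedDeriv k (fun s : ℂ => blk (cxLapF K c m2 (U₀ + s • δU) ((fun b => (U₀ b)ᴴ) + s • δV))⁻¹ x y) 0‖
      ≤ k.factorial * (m2 - 2 * ((d : ℝ) + 1) * c * R)⁻¹ / R ^ k := by
  have hwin' : 2 * ((d : ℝ) + 1) * c * (0 + R) < m2 := by rwa [zero_add]
  have h := norm_iteratedDeriv_blk_cxLapF_inv_line_le K hc hm le_rfl hR hwin' (unitary_mem_window K hU₀).1 (unitary_mem_window K hU₀).2 hδU hδV k x y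
  rwa [zero_add] at h

end Summit.QuantumFields.YangMills.BalabanUVNodes.N15KingModelRung.Covariant

end
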